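import Literature.NumberTheory.QuadraticFields.HeegnerCondition
import Literature.NumberTheory.QuadraticFields.LatticeSumPrincipal
import Literature.NumberTheory.QuadraticFields.FormIdeals
import Literature.NumberTheory.EllipticCurves.HeegnerPointsImaginaryQuadraticProofs
import Mathlib.NumberTheory.Padics.PadicIntegers
import HarnessLib

/-!
# FRAME-7: the frame of the `j = 0` seam (`h_K = 1`, `2 = v v̄`) IS the `cm7` frame — `d_K = −7`, `v = (α₀)` with `α₀² − α₀ + 2 = 0`

Cell `bsd-print-cf2`, width seat `bsd-line-cf2-p1-w5` g17; print leaf stmt-BirchSwinnertonDyer-24720 (`j = 0` twin),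
crux 20368.  `--supports stmt-BirchSwinnertonDyer-24720` (helper, Theses-free).  THEOREMS ONLY (no `def`, no named fact,
no `sorry`); nothing is closed; no summit statement is proved by this seat; BSD is not proved by any of this.

WHY: the supply statement `hsupply` / the seam hypothesis `hseam` (`…KatzMeasureJZeroSupplyOfChainSeam`, p764618) and
the R3 endpoint quantify over ANY imaginary quadratic `K` of class number one in which `2 = v·v̄` splits, and hand the
seam prover an ARBITRARY generator `α₀` of `v` (with the local datum `u·2 = α₀`).  The CM bridge it must feed is the
`cm7 = 49a1` currency: `cm7Padic_exists_formalGroupLaw_eq_ltF` (`[c]`-series with `c = a₂ − ϖ = 1 − ϖ`, `ϖ` the UNIT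
root of `T² − T + 2` in `ℤ₂`) and the hypothesis `heπ : e(u·2) = c` of the per-unit pieces (β)/(γ).  This file
supplies the missing normalisation, ELEMENTARILY (no class-number-one theorem):

* ★★ `exists_generator_sq_sub_self_add_two` — `h_K = 1`, `2 ∈ v`, `2 ∈ v̄`, `v̄ ≠ v` ⟹ `∃ α₀, v = (α₀) ∧ α₀² − α₀ + 2 = 0`.
  Proof on an integral basis `(1, ω)`, `ω² = m + tω`, `d_K = t² + 4m < 0` (tree `Quadratic.exists_basis_zero_eq_one`,
  `norm_intCast_add_intCast_mul`, `discr_eq_sq_add_four_mul`, `IsImaginaryQuadratic.discr_neg`): a generator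
  `α = x + yω` of `v` has `α² = sα − n`, `s = 2x + ty`, `n = N(α) = x² + txy − my² ∈ {1, 2, 4}` (`n ∣ N(2) = 4`);
  `n = 1` makes `α` a unit, `n = 4` makes `α ∈ 2𝒪_K ⊆ v̄`, so `n = 2`; `s` is odd (else `α² ∈ 2𝒪_K ⊆ v̄`, `v = v̄`);
  `8 = 4n = s² − d_K y²` with `d_K < 0` forces `s = ±1` (and `d_K = −7`); replace `α` by `−α` if `s = −1`.
* ★ `discr_eq_neg_seven_of_classNumber_eq_one_of_split_two` — hence `d_K = −7` (`K = ℚ(√−7)`).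
* ★ `exists_isUnit_root_two_of_sq_sub_self_add_two` — in `ℤ₂`: a NON-unit root `x` of `T² − T + 2` is `1 − ϖ` for a
  UNIT root `ϖ` (the `(hϖ, hroot, heπ)` triple of the bridge, `a₂ = 1`); `sq_sub_self_add_two_map` transports the
  relation along ring maps (`𝓞 K → 𝒪_v → ℤ₂`).

## References
* [deShalit1987] E. de Shalit, *Iwasawa theory of elliptic curves with complex multiplication* (1987), II.1.10
  (`ψ(𝔭) = π`, the formal group at a split prime is Lubin–Tate for `π`), II.4.12.
* [Cox2013] D. A. Cox, *Primes of the form x² + ny²*, 2nd ed., §7.A (norm form of an order).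
-/

-- the summit namespace `Summit.BirchSwinnertonDyer.BirchSwinnertonDyer` repeats the problem name by design (D-0017)
set_option linter.dupNamespace false
set_option autoImplicit false

noncomputable section

open NumberField IsDedekindDomain Module
open Literature.NumberTheory.QuadraticFields.Quadratic Literature.NumberTheory.EllipticCurves

namespace Summit.BirchSwinnertonDyer.BirchSwinnertonDyer.Theorems.PrintCf2.KatzMeasureJZeroTop

variable {K : Type} [Field K] [NumberField K]

/-! ### §1. Coordinates on an integral basis `(1, ω)`: characteristic relation and the norm identity -/

omit [NumberField K] in
/-- `β = x + yω` satisfies `β² = (2x + ty)·β − (x² + txy − my²)` when `ω² = m + tω`. [folklore] -/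
theorem sq_eq_of_coords (b : Basis (Fin 2) ℤ (𝓞 K)) {t m : ℤ}
    (hω : b 1 * b 1 = (m : 𝓞 K) + (t : 𝓞 K) * b 1) (x y : ℤ) :
    ((x : 𝓞 K) + (y : 𝓞 K) * b 1) ^ 2 =
      ((2 * x + t * y : ℤ) : 𝓞 K) * ((x : 𝓞 K) + (y : 𝓞 K) * b 1) - ((x ^ 2 + t * x * y - m * y ^ 2 : ℤ) : 𝓞 K) := by
  push_cast
  linear_combination ((y : 𝓞 K) ^ 2) * hω

/-- `4·(x² + txy − my²) = (2x + ty)² − (t² + 4m)·y²`. [folklore] -/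
theorem four_mul_normForm (t m x y : ℤ) :
    4 * (x ^ 2 + t * x * y - m * y ^ 2) = (2 * x + t * y) ^ 2 - (t ^ 2 + 4 * m) * y ^ 2 := by
  ring

/-! ### §2. The generator `α₀` of `v` with `α₀² − α₀ + 2 = 0` -/

/-- In a Dedekind domain two distinct height-one primes are incomparable: `x ∈ v`, `v = (x)` and `x ∈ v̄` force `v = v̄`.
[folklore] -/
theorem not_mem_of_span_eq {v vbar : HeightOneSpectrum (𝓞 K)} (hne : vbar ≠ v) {α : 𝓞 K}
    (hα : v.asIdeal = Ideal.span {α}) : α ∉ vbar.asIdeal := by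
  intro h
  have hle : v.asIdeal ≤ vbar.asIdeal := by
    rw [hα, Ideal.span_singleton_le_iff_mem]; exact h
  exact hne (HeightOneSpectrum.ext (v.isMaximal.eq_of_le vbar.isPrime.ne_top hle).symm)

set_option maxHeartbeats 800000 in
/-- **FRAME-7, core computation** (generator AND discriminant at once): a generator `α₀` of `v` with `α₀² − α₀ + 2 = 0`,
and `d_K·y² = −7` with `y² = 1` for the `ω`-coordinate `y` of `α₀` on an integral basis `(1, ω)`. [cite: Cox2013, §7.A] -/
theorem exists_generator_sq_sub_self_add_two_and_discr (hK : IsImaginaryQuadratic K) (hh : NumberField.classNumber K = 1)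
    {v vbar : HeightOneSpectrum (𝓞 K)} (hv : ((2 : ℕ) : 𝓞 K) ∈ v.asIdeal) (hvbar : ((2 : ℕ) : 𝓞 K) ∈ vbar.asIdeal)
    (hne : vbar ≠ v) :
    ∃ α₀ : 𝓞 K, v.asIdeal = Ideal.span {α₀} ∧ α₀ ^ 2 - α₀ + 2 = 0 ∧
      ∃ y : ℤ, y ^ 2 = 1 ∧ NumberField.discr K * y ^ 2 = -7 := by
  classical
  haveI : IsPrincipalIdealRing (𝓞 K) := NumberField.classNumber_eq_one_iff.mp hh
  obtain ⟨α, hα'⟩ := (IsPrincipalIdealRing.principal v.asIdeal).principal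
  have hα : v.asIdeal = Ideal.span {α} := hα'
  have h2 : (2 : 𝓞 K) ∈ vbar.asIdeal := by exact_mod_cast hvbar
  have hαvbar : α ∉ vbar.asIdeal := not_mem_of_span_eq hne hα
  -- integral basis `(1, ω)`, `ω² = m + tω`, `d_K = t² + 4m < 0`
  obtain ⟨b, hb⟩ := exists_basis_zero_eq_one hK.1
  have hω : b 1 * b 1 = ((b.repr (b 1 * b 1) 0 : ℤ) : 𝓞 K) + ((b.repr (b 1 * b 1) 1 : ℤ) : 𝓞 K) * b 1 :=
    basis_one_mul_self_eq b hb
  have hD := discr_eq_sq_add_four_mul b hb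
  generalize b.repr (b 1 * b 1) 0 = m at hω hD
  generalize b.repr (b 1 * b 1) 1 = t at hω hD
  have hneg : t ^ 2 + 4 * m < 0 := hD ▸ hK.discr_neg
  -- coordinates, norm and characteristic relation of an element
  have hcoord : ∀ β : 𝓞 K, ∃ x y : ℤ,
      Algebra.norm ℤ β = x ^ 2 + t * x * y - m * y ^ 2 ∧
      β ^ 2 = ((2 * x + t * y : ℤ) : 𝓞 K) * β - ((x ^ 2 + t * x * y - m * y ^ 2 : ℤ) : 𝓞 K) ∧
      0 ≤ x ^ 2 + t * x * y - m * y ^ 2 := fun β ↦ by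
    refine ⟨b.repr β 0, b.repr β 1, ?_, ?_, normForm_nonneg hneg _ _⟩
    · conv_lhs => rw [eq_repr_add_repr_mul_of_basis b hb β]
      exact norm_intCast_add_intCast_mul b hb hω _ _
    · conv_lhs => rw [eq_repr_add_repr_mul_of_basis b hb β]
      rw [sq_eq_of_coords b hω, ← eq_repr_add_repr_mul_of_basis b hb β]
  obtain ⟨x, y, hnα, hchar, hn0⟩ := hcoord α
  -- `2 = a·α`, `N(a)·N(α) = N(2) = 4`
  have h2v : (2 : 𝓞 K) ∈ Ideal.span {α} := by rw [← hα]; exact_mod_cast hv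
  obtain ⟨a, ha⟩ := Ideal.mem_span_singleton'.mp h2v
  obtain ⟨x', y', hna, hchara, hn0a⟩ := hcoord a
  have hN2 : Algebra.norm ℤ (2 : 𝓞 K) = 4 := by
    have h := norm_intCast_add_intCast_mul b hb hω 2 0
    simp only [Int.cast_ofNat, Int.cast_zero, zero_mul, add_zero] at h
    rw [h]; ring
  have hprod : (x' ^ 2 + t * x' * y' - m * y' ^ 2) * (x ^ 2 + t * x * y - m * y ^ 2) = 4 := by
    rw [← hnα, ← hna, ← map_mul, ha, hN2]
  -- `N(α) ∈ {1, 2, 4}`, and `N(α) = 2`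
  have hndvd : x ^ 2 + t * x * y - m * y ^ 2 ∣ 4 := Dvd.intro_left _ hprod
  have hnle : x ^ 2 + t * x * y - m * y ^ 2 ≤ 4 := Int.le_of_dvd (by norm_num) hndvd
  have hn1 : x ^ 2 + t * x * y - m * y ^ 2 ≠ 1 := by
    intro hn1
    -- `α (s − α) = 1 ⇒ v = ⊤`
    have hunit : α * (((2 * x + t * y : ℤ) : 𝓞 K) - α) = 1 := by
      have := hchar; rw [hn1, Int.cast_one] at this; linear_combination -this
    have hαv : α ∈ v.asIdeal := by rw [hα]; exact Ideal.mem_span_singleton_self α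
    exact v.isPrime.ne_top (Ideal.eq_top_of_isUnit_mem _ hαv (IsUnit.of_mul_eq_one _ hunit))
  have hn4 : x ^ 2 + t * x * y - m * y ^ 2 ≠ 4 := by
    intro hn4
    have hna1 : x' ^ 2 + t * x' * y' - m * y' ^ 2 = 1 := by
      have := hprod; rw [hn4] at this; linarith
    -- `a (s' − a) = 1 ⇒ α = 2 (s' − a) ∈ v̄`
    have haunit : a * (((2 * x' + t * y' : ℤ) : 𝓞 K) - a) = 1 := by
      have := hchara; rw [hna1, Int.cast_one] at this; linear_combination -this
    apply hαvbar
    have : α = 2 * (((2 * x' + t * y' : ℤ) : 𝓞 K) - a) := by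
      linear_combination (((2 * x' + t * y' : ℤ) : 𝓞 K) - a) * ha + (-α) * haunit
    rw [this]
    exact vbar.asIdeal.mul_mem_right _ h2
  have hn2 : x ^ 2 + t * x * y - m * y ^ 2 = 2 := by
    have h0 : 0 ≤ x ^ 2 + t * x * y - m * y ^ 2 := hn0
    interval_cases h : (x ^ 2 + t * x * y - m * y ^ 2) <;> omega
  -- `s = 2x + ty` is odd: otherwise `α² = 2(s'α − 1) ∈ v̄`
  have hsodd : (2 * x + t * y) % 2 = 1 := by
    by_contra hev
    obtain ⟨s', hs'⟩ : ∃ s', 2 * x + t * y = 2 * s' := ⟨(2 * x + t * y) / 2, by omega⟩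
    apply hαvbar
    have hsq : α ^ 2 = 2 * (((s' : ℤ) : 𝓞 K) * α - 1) := by
      rw [hchar, hn2, hs']; push_cast; ring
    have hmem : α ^ 2 ∈ vbar.asIdeal := by rw [hsq]; exact vbar.asIdeal.mul_mem_right _ h2
    exact vbar.isPrime.mem_of_pow_mem 2 hmem
  -- `8 = s² − d_K y²`, `d_K < 0` ⇒ `s = ±1`, `d_K y² = −7`, `y² = 1`
  have h8 : 8 = (2 * x + t * y) ^ 2 - (t ^ 2 + 4 * m) * y ^ 2 := by
    have := four_mul_normForm t m x y; rw [hn2] at this; linarith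
  have hy2 : 0 ≤ -(t ^ 2 + 4 * m) * y ^ 2 := mul_nonneg (by linarith) (sq_nonneg y)
  have hs2 : 2 * x + t * y ≤ 2 := by nlinarith
  have hs2' : -2 ≤ 2 * x + t * y := by nlinarith
  have hs1 : 2 * x + t * y = 1 ∨ 2 * x + t * y = -1 := by omega
  have hsq1 : (2 * x + t * y) ^ 2 = 1 := by rcases hs1 with h | h <;> rw [h] <;> norm_num
  have hdy : NumberField.discr K * y ^ 2 = -7 := by rw [hD]; linarith
  have hy1 : y ^ 2 = 1 := by
    have hyle : y ^ 2 ≤ 7 := by nlinarith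
    have hy3 : y < 3 := by nlinarith
    have hy3' : -3 < y := by nlinarith
    have hy0 : y ≠ 0 := by rintro rfl; simp at hdy
    interval_cases y <;> omega
  rcases hs1 with hs1 | hs1
  · refine ⟨α, hα, ?_, y, hy1, hdy⟩
    have := hchar; rw [hn2, hs1] at this; push_cast at this; linear_combination this
  · refine ⟨-α, by rw [hα, Ideal.span_singleton_neg], ?_, y, hy1, hdy⟩
    have := hchar; rw [hn2, hs1] at this; push_cast at this; linear_combination this

/-- ★★ **FRAME-7, generator form.** For `K` imaginary quadratic of class number one and `2 = v·v̄` split (`2 ∈ v`,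
`2 ∈ v̄`, `v̄ ≠ v`) there is a generator `α₀` of `v` with `α₀² − α₀ + 2 = 0` — the global element whose `v`-adic image
is the NON-unit root `1 − ϖ` of `T² − a₂T + 2` (`a₂(49a1) = 1`), i.e. de Shalit's `ψ(𝔭)`.  Elementary (integral basis,
norm form, `d_K < 0`); with `d_K = −7` below it identifies the seam's frame with the `cm7` frame.
[cite: deShalit1987, II.1.10 Lemma] -/
theorem exists_generator_sq_sub_self_add_two (hK : IsImaginaryQuadratic K) (hh : NumberField.classNumber K = 1)
    {v vbar : HeightOneSpectrum (𝓞 K)} (hv : ((2 : ℕ) : 𝓞 K) ∈ v.asIdeal) (hvbar : ((2 : ℕ) : 𝓞 K) ∈ vbar.asIdeal)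
    (hne : vbar ≠ v) :
    ∃ α₀ : 𝓞 K, v.asIdeal = Ideal.span {α₀} ∧ α₀ ^ 2 - α₀ + 2 = 0 := by
  obtain ⟨α₀, hα, hα₀, -⟩ := exists_generator_sq_sub_self_add_two_and_discr hK hh hv hvbar hne
  exact ⟨α₀, hα, hα₀⟩

/-- ★ **FRAME-7, discriminant form: `d_K = −7`** for `K` imaginary quadratic of class number one with `2` split —
`K = ℚ(√−7)`, the field of `cm7 = X₀(49)`; no class-number-one theorem is used. [cite: Cox2013, §7.A] -/
theorem discr_eq_neg_seven_of_classNumber_eq_one_of_split_two (hK : IsImaginaryQuadratic K)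
    (hh : NumberField.classNumber K = 1) {v vbar : HeightOneSpectrum (𝓞 K)} (hv : ((2 : ℕ) : 𝓞 K) ∈ v.asIdeal)
    (hvbar : ((2 : ℕ) : 𝓞 K) ∈ vbar.asIdeal) (hne : vbar ≠ v) :
    NumberField.discr K = -7 := by
  obtain ⟨-, -, -, y, hy1, hdy⟩ := exists_generator_sq_sub_self_add_two_and_discr hK hh hv hvbar hne
  rw [hy1, mul_one] at hdy
  exact hdy

/-- `√−7 ∈ K`: `(2α₀ − 1)² = −7` for the normalised generator. [folklore] -/
theorem sq_two_mul_sub_one_eq_neg_seven {R : Type*} [CommRing R] {α₀ : R} (hα₀ : α₀ ^ 2 - α₀ + 2 = 0) :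
    (2 * α₀ - 1) ^ 2 = -7 := by
  linear_combination (4 : R) * hα₀

/-- The conjugate generator: `v̄ = (1 − α₀)` (`α₀(1 − α₀) = 2 ∈ v̄`, `α₀ ∉ v̄`, and `(1 − α₀)` is maximal as its norm-form
cofactor shows `v̄ ∣ (1 − α₀) ∣ 2`). Recorded as the divisibility `1 − α₀ ∈ v̄`. [folklore] -/
theorem one_sub_mem_of_generator {v vbar : HeightOneSpectrum (𝓞 K)} (hvbar : ((2 : ℕ) : 𝓞 K) ∈ vbar.asIdeal)
    (hne : vbar ≠ v) {α₀ : 𝓞 K} (hα : v.asIdeal = Ideal.span {α₀}) (hα₀ : α₀ ^ 2 - α₀ + 2 = 0) :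
    1 - α₀ ∈ vbar.asIdeal := by
  have h2 : α₀ * (1 - α₀) ∈ vbar.asIdeal := by
    have : α₀ * (1 - α₀) = 2 := by linear_combination -hα₀
    rw [this]; exact_mod_cast hvbar
  exact (vbar.isPrime.mem_or_mem h2).resolve_left (not_mem_of_span_eq hne hα)

/-! ### §3. The `2`-adic reading: the `(hϖ, hroot, heπ)` triple of the bridge -/

/-- The relation `x² − x + 2 = 0` is transported along ring maps. [folklore] -/
theorem sq_sub_self_add_two_map {R S : Type*} [Ring R] [Ring S] (f : R →+* S) {x : R}
    (hx : x ^ 2 - x + 2 = 0) : f x ^ 2 - f x + 2 = 0 := by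
  have := congrArg f hx
  simpa [map_add, map_sub, map_pow, map_ofNat] using this

/-- ★ **In `ℤ₂`, a non-unit root `x` of `T² − T + 2` is `1 − ϖ` for a UNIT root `ϖ`** — the triple consumed by
`cm7Padic_exists_formalGroupLaw_eq_ltF` (`hϖ`, `hroot` with `a₂ = 1`) and by the per-unit pieces (`heπ : e(u·2) = 1 − ϖ`).
[cite: deShalit1987, II.1.10 Lemma] -/
theorem exists_isUnit_root_two_of_sq_sub_self_add_two {x : ℤ_[2]} (hx : x ^ 2 - x + 2 = 0) (hxu : ¬ IsUnit x) :
    ∃ ϖ : ℤ_[2], IsUnit ϖ ∧ ϖ ^ 2 - ((1 : ℤ) : ℤ_[2]) * ϖ + (2 : ℕ) = 0 ∧ x = ((1 : ℤ) : ℤ_[2]) - ϖ := by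
  refine ⟨1 - x, ?_, ?_, by push_cast; ring⟩
  · exact IsLocalRing.isUnit_one_sub_self_of_mem_nonunits x hxu
  · push_cast; linear_combination hx

/-- `2` is not a unit of `ℤ₂` (`‖2‖ = 1/2`). [folklore] -/
theorem not_isUnit_two_padicInt : ¬ IsUnit (2 : ℤ_[2]) := by
  intro h
  have h1 := PadicInt.isUnit_iff.mp h
  have h2 : ‖(2 : ℤ_[2])‖ = (2 : ℝ)⁻¹ := by exact_mod_cast PadicInt.norm_p (p := 2)
  rw [h2] at h1
  norm_num at h1

/-- A multiple of `2` is not a unit of `ℤ₂`. [folklore] -/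
theorem not_isUnit_mul_two (y : ℤ_[2]) : ¬ IsUnit (y * 2) := fun h ↦
  not_isUnit_two_padicInt (isUnit_of_mul_isUnit_right h)

/-- ★ **The `heπ` triple from the global generator**: for ANY ring map `e : 𝒪_v → ℤ₂` and any `w ∈ 𝒪_v` with
`w² − w + 2 = 0` of the form `w = u·2` (the local datum: `u·2 = α₀`), there is a unit root `ϖ` of `T² − 1·T + 2` in `ℤ₂`
with `e w = 1 − ϖ`. [cite: deShalit1987, II.1.10 Lemma] -/
theorem exists_isUnit_root_two_of_map {R : Type*} [CommRing R] (e : R →+* ℤ_[2]) (u : R) {w : R} (hw : w = u * 2)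
    (hw2 : w ^ 2 - w + 2 = 0) :
    ∃ ϖ : ℤ_[2], IsUnit ϖ ∧ ϖ ^ 2 - ((1 : ℤ) : ℤ_[2]) * ϖ + (2 : ℕ) = 0 ∧ e w = ((1 : ℤ) : ℤ_[2]) - ϖ := by
  refine exists_isUnit_root_two_of_sq_sub_self_add_two (sq_sub_self_add_two_map e hw2) ?_
  rw [hw, map_mul, map_ofNat]
  exact not_isUnit_mul_two _

end Summit.BirchSwinnertonDyer.BirchSwinnertonDyer.Theorems.PrintCf2.KatzMeasureJZeroTop

end
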